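import Mathlib.CategoryTheory.Sites.Limits
import Mathlib.CategoryTheory.Limits.Constructions.EpiMono
import Mathlib.CategoryTheory.Limits.FunctorCategory.EpiMono
import Mathlib.CategoryTheory.Limits.Shapes.Biproducts
import Mathlib.Algebra.Category.Grp.EpiMono
import Mathlib.Algebra.Category.Grp.Limits
import Mathlib.Algebra.Category.ModuleCat.Sheaf.Limits
import Mathlib.Algebra.Category.ModuleCat.Sheaf.Free
import Mathlib.AlgebraicGeometry.Modules.Sheaf
import HarnessLib

/-!
# Torsion-free sections: `Mono (m • 𝟙 F)` ↔ "no section of `F` is killed by `m`"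

The generic homological algebra of the `p`-adic staircase complexes of this tree
(`Algebra/Homology/StaircaseComplexes`, `StaircaseExact`, `StaircaseTorsionFree`: the carriers of
X. Hu's complexes `p^{(r-j)M} Ωʲ_{X_{(r-j)N}}`, arXiv:2507.12458, Def. 8.2) is written for an object
`T` of an abelian category and takes "`T` has no `q`-torsion" in the categorical form
`[Mono ((q : ℤ) • 𝟙 T)]`. Geometrically one knows instead that the SECTIONS of `𝒪_𝒳` and of
`Ωʲ_{𝒳/W}` over every open have no `p`-torsion (flatness over `W`, local freeness of `Ωʲ` for
`𝒳/W` smooth). This file is the dictionary between the two, for abelian sheaves on any site, for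
sheaves of modules over a sheaf of rings, and for `𝒪_X`-modules on a scheme:

* `mono_iff_injective_app` — a morphism of abelian sheaves is a monomorphism iff it is injective
  on sections over every object (sheaves ↪ presheaves is faithful and preserves limits, and
  monomorphisms of presheaves / of abelian groups are the objectwise injections);
* `zsmul_id_hom_app_apply` — `m • 𝟙 F` acts on sections as `s ↦ m • s` (`rfl`);
* `mono_zsmul_id_iff_torsionFree` — **`Mono (m • 𝟙 F) ↔ ∀ U, ∀ s ∈ F(U), m • s = 0 → s = 0`**,
  with the two directions `mono_zsmul_id_of_torsionFree`, `eq_zero_of_zsmul_eq_zero_of_mono` and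
  the topological-space form `mono_zsmul_id_iff_torsionFree_opens`;
* `SheafOfModules.mono_zsmul_id_iff_torsionFree`,
  `SheafOfModules.mono_zsmul_id_toSheaf_iff_torsionFree`,
  `SheafOfModules.mono_zsmul_id_iff_mono_zsmul_id_toSheaf` — the same for a sheaf of modules `M`
  over `R : Sheaf J RingCat`, both for `M` itself and for its underlying abelian sheaf
  `(SheafOfModules.toSheaf R).obj M` (whose sections ARE those of `M`);
* `SheafOfModules.mono_zsmul_id_unit_iff`, `SheafOfModules.mono_zsmul_id_free` — the structure
  sheaf `𝒪 = SheafOfModules.unit R` is `m`-torsion-free iff every ring of sections `R(U)` is, and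
  then so is every free module `SheafOfModules.free I` of finite rank;
* `schemeModules_mono_zsmul_id_iff_torsionFree` — the form for `M : X.Modules` on a scheme `X`
  with the sections `Γ(M, U)`; `schemeModules_mono_zsmul_id_iff_of_iso_unit`,
  `schemeModules_mono_zsmul_id_of_iso_free` — trivial bundles `M ≅ 𝒪_X`, `M ≅ 𝒪_X^I` (`I`
  finite) are `m`-torsion-free iff / as soon as the rings `Γ(X, U)` are;
* generalities in a preadditive category: `m`-torsion-freeness passes to subobjects
  (`mono_zsmul_id_of_mono`), along isomorphisms, through additive functors preserving and
  reflecting monomorphisms (`mono_zsmul_id_obj_iff`), to products (`mono_zsmul_id_piObj`) and to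
  biproducts (`mono_zsmul_id_sigmaObj`).

[folklore] Everything is proved; no named facts. Mathlib searched (pin v4.32):
`Sheaf.Hom.mono_iff_presheaf_mono` (needs concrete sheafification; we use instead
`Functor.mono_map_iff_mono` for `sheafToPresheaf`, which creates limits, `Sites/Limits`),
`NatTrans.mono_iff_mono_app`, `AddCommGrpCat.mono_iff_injective`, `injective_iff_map_eq_zero`,
`SheafOfModules.toSheaf` (`PreservesFiniteLimits`, `Faithful`, `Additive`),
`Limits.Sigma.map_mono`, `HasFiniteBiproducts.of_hasFiniteProducts` (used); Mathlib has no
statement relating `Mono (m • 𝟙 _)` to torsion in sections.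

NOT here: torsion-freeness of LOCALLY free modules of finite rank (needs "mono is local on the
base"); the geometric inputs themselves (`𝒪_𝒳` flat over `W(k)` has no `p`-torsion, `Ωʲ_{𝒳/W}`
locally free for `𝒳/W` smooth); the passage from `m : ℤ` to powers `m ^ e` (see
`Literature.Algebra.Homology.mono_pow_smul_id`).
-/

namespace Literature.AlgebraicGeometry.Modules

open _root_.CategoryTheory _root_.CategoryTheory.Limits Opposite

universe w v u v₁ u₁

/-! ### Generalities in a preadditive category -/

section Preadditive

variable {𝒜 : Type u} [Category.{v} 𝒜] [Preadditive 𝒜]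

/-- A subobject of an object without `m`-torsion has no `m`-torsion: if `ι : M ⟶ N` is a
monomorphism and `m • 𝟙 N` is a monomorphism, so is `m • 𝟙 M`. [folklore] -/
theorem mono_zsmul_id_of_mono (m : ℤ) {M N : 𝒜} (ι : M ⟶ N) [Mono ι] [Mono (m • 𝟙 N)] :
    Mono (m • 𝟙 M) := by
  have h : (m • 𝟙 M) ≫ ι = ι ≫ (m • 𝟙 N) := by
    rw [Preadditive.zsmul_comp, Category.id_comp, Preadditive.comp_zsmul, Category.comp_id]
  haveI : Mono ((m • 𝟙 M) ≫ ι) := by rw [h]; exact mono_comp _ _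
  exact mono_of_mono _ ι

/-- `m`-torsion-freeness (`Mono (m • 𝟙 _)`) is invariant under isomorphism. [folklore] -/
theorem mono_zsmul_id_iff_of_iso (m : ℤ) {M N : 𝒜} (e : M ≅ N) :
    Mono (m • 𝟙 M) ↔ Mono (m • 𝟙 N) :=
  ⟨fun _ ↦ mono_zsmul_id_of_mono m e.inv, fun _ ↦ mono_zsmul_id_of_mono m e.hom⟩

/-- An additive functor which preserves and reflects monomorphisms preserves and reflects
`m`-torsion-freeness: `Mono (m • 𝟙 (F M)) ↔ Mono (m • 𝟙 M)`. [folklore] -/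
theorem mono_zsmul_id_obj_iff (m : ℤ) {ℬ : Type u₁} [Category.{v₁} ℬ] [Preadditive ℬ]
    (F : 𝒜 ⥤ ℬ) [F.Additive] [F.PreservesMonomorphisms] [F.ReflectsMonomorphisms] (M : 𝒜) :
    Mono (m • 𝟙 (F.obj M)) ↔ Mono (m • 𝟙 M) := by
  rw [← F.mono_map_iff_mono, F.map_zsmul, F.map_id]

/-- A product of objects without `m`-torsion has no `m`-torsion. [folklore] -/
theorem mono_zsmul_id_piObj (m : ℤ) {β : Type w} (T : β → 𝒜) [HasProduct T]
    (h : ∀ b, Mono (m • 𝟙 (T b))) : Mono (m • 𝟙 (∏ᶜ T)) := by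
  have e : (m • 𝟙 (∏ᶜ T)) = Limits.Pi.map fun b ↦ m • 𝟙 (T b) := by
    ext b
    rw [Limits.Pi.map_π, Preadditive.zsmul_comp, Category.id_comp, Preadditive.comp_zsmul,
      Category.comp_id]
  rw [e]
  infer_instance

/-- A biproduct (finite direct sum) of objects without `m`-torsion has no `m`-torsion, stated for
the coproduct `∐ T` of a family admitting a biproduct. [folklore] -/
theorem mono_zsmul_id_sigmaObj (m : ℤ) {β : Type w} (T : β → 𝒜) [HasBiproduct T]
    (h : ∀ b, Mono (m • 𝟙 (T b))) : Mono (m • 𝟙 (∐ T)) := by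
  have e : (m • 𝟙 (∐ T)) = Limits.Sigma.map fun b ↦ m • 𝟙 (T b) := by
    ext b
    rw [Limits.Sigma.ι_map, Preadditive.zsmul_comp, Category.id_comp, Preadditive.comp_zsmul,
      Category.comp_id]
  rw [e]
  infer_instance

end Preadditive

/-! ### Abelian sheaves on a site -/

section Sheaf

variable {C : Type u} [Category.{v} C] {J : GrothendieckTopology C}
variable {F G : Sheaf J AddCommGrpCat.{w}}

/-- A morphism of abelian sheaves is a monomorphism iff the underlying morphism of presheaves is
(the forgetful functor to presheaves is faithful and preserves limits). [folklore] -/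
theorem mono_iff_mono_hom (f : F ⟶ G) : Mono f ↔ Mono f.hom :=
  ((sheafToPresheaf J AddCommGrpCat.{w}).mono_map_iff_mono (f := f)).symm

/-- **A morphism of abelian sheaves is a monomorphism iff it is injective on sections over every
object of the site.** [folklore] -/
theorem mono_iff_injective_app (f : F ⟶ G) :
    Mono f ↔ ∀ U : Cᵒᵖ, Function.Injective (f.hom.app U) := by
  rw [mono_iff_mono_hom, NatTrans.mono_iff_mono_app]
  exact forall_congr' fun U ↦ AddCommGrpCat.mono_iff_injective _

/-- On sections, `m • f` is `s ↦ m • f(s)`. [folklore] -/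
theorem zsmul_hom_app_apply (m : ℤ) (f : F ⟶ G) (U : Cᵒᵖ) (s : F.obj.obj U) :
    (m • f).hom.app U s = m • f.hom.app U s :=
  rfl

/-- On sections, `m • 𝟙 F` is multiplication by `m`. [folklore] -/
theorem zsmul_id_hom_app_apply (m : ℤ) (U : Cᵒᵖ) (s : F.obj.obj U) :
    (m • 𝟙 F : F ⟶ F).hom.app U s = m • s :=
  rfl

variable (F) in
/-- **Dictionary "`m • 𝟙 F` mono ↔ sections `m`-torsion-free"**: for an abelian sheaf `F` on a
site and `m : ℤ`, `m • 𝟙 F` is a monomorphism iff for every object `U` and every section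
`s ∈ F(U)`, `m • s = 0` implies `s = 0`. [folklore] -/
theorem mono_zsmul_id_iff_torsionFree (m : ℤ) :
    Mono (m • 𝟙 F) ↔ ∀ (U : Cᵒᵖ) (s : F.obj.obj U), m • s = 0 → s = 0 := by
  rw [mono_iff_injective_app]
  refine forall_congr' fun U ↦ ?_
  rw [injective_iff_map_eq_zero ((m • 𝟙 F : F ⟶ F).hom.app U).hom]
  rfl

variable (F) in
/-- If the sections of `F` have no `m`-torsion then `m • 𝟙 F` is a monomorphism (the direction
used to feed `[Mono ((q : ℤ) • 𝟙 T)]` hypotheses). [folklore] -/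
theorem mono_zsmul_id_of_torsionFree (m : ℤ)
    (h : ∀ (U : Cᵒᵖ) (s : F.obj.obj U), m • s = 0 → s = 0) : Mono (m • 𝟙 F) :=
  (mono_zsmul_id_iff_torsionFree F m).mpr h

variable (F) in
/-- If `m • 𝟙 F` is a monomorphism then no nonzero section of `F` is killed by `m`. [folklore] -/
theorem eq_zero_of_zsmul_eq_zero_of_mono (m : ℤ) [Mono (m • 𝟙 F)] {U : Cᵒᵖ} {s : F.obj.obj U}
    (hs : m • s = 0) : s = 0 :=
  (mono_zsmul_id_iff_torsionFree F m).mp ‹_› U s hs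

variable (F) in
/-- If `m • 𝟙 F` is a monomorphism then multiplication by `m` is injective on every group of
sections `F(U)`. [folklore] -/
theorem zsmul_right_injective_of_mono (m : ℤ) [Mono (m • 𝟙 F)] (U : Cᵒᵖ) :
    Function.Injective fun s : F.obj.obj U ↦ m • s :=
  (mono_iff_injective_app (m • 𝟙 F)).mp ‹_› U

/-- The same dictionary for an abelian sheaf on a topological space `X`, quantifying over the
opens `U` of `X`. [folklore] -/
theorem mono_zsmul_id_iff_torsionFree_opens {X : TopCat.{v}}
    (F : Sheaf (Opens.grothendieckTopology X) AddCommGrpCat.{w}) (m : ℤ) :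
    Mono (m • 𝟙 F) ↔
      ∀ (U : TopologicalSpace.Opens X) (s : F.obj.obj (op U)), m • s = 0 → s = 0 := by
  rw [mono_zsmul_id_iff_torsionFree]
  exact ⟨fun h U ↦ h (op U), fun h U ↦ h U.unop⟩

end Sheaf

/-! ### Sheaves of modules -/

section SheafOfModules

variable {C : Type u₁} [Category.{v₁} C] {J : GrothendieckTopology C} {R : Sheaf J RingCat.{u}}

/-- For a sheaf of modules `M` with underlying abelian sheaf `A`, `m • 𝟙 A` is a monomorphism iff
the sections of `M` have no `m`-torsion (the sections of `A` over `U` are those of `M`).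
[folklore] -/
theorem SheafOfModules.mono_zsmul_id_toSheaf_iff_torsionFree (M : SheafOfModules.{v} R) (m : ℤ) :
    Mono (m • 𝟙 ((SheafOfModules.toSheaf R).obj M)) ↔
      ∀ (U : Cᵒᵖ) (s : M.val.obj U), m • s = 0 → s = 0 :=
  mono_zsmul_id_iff_torsionFree _ m

/-- For a sheaf of modules `M`, `m • 𝟙 M` is a monomorphism of sheaves of modules iff `m • 𝟙` is
a monomorphism on the underlying abelian sheaf (the forgetful functor is faithful, additive and
preserves finite limits). [folklore] -/
theorem SheafOfModules.mono_zsmul_id_iff_mono_zsmul_id_toSheaf (M : SheafOfModules.{v} R)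
    (m : ℤ) :
    Mono (m • 𝟙 M) ↔ Mono (m • 𝟙 ((SheafOfModules.toSheaf R).obj M)) :=
  (mono_zsmul_id_obj_iff m (SheafOfModules.toSheaf R) M).symm

/-- **Dictionary for sheaves of modules**: `m • 𝟙 M` is a monomorphism iff for every `U` and every
section `s ∈ M(U)`, `m • s = 0` implies `s = 0`. [folklore] -/
theorem SheafOfModules.mono_zsmul_id_iff_torsionFree (M : SheafOfModules.{v} R) (m : ℤ) :
    Mono (m • 𝟙 M) ↔ ∀ (U : Cᵒᵖ) (s : M.val.obj U), m • s = 0 → s = 0 :=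
  (SheafOfModules.mono_zsmul_id_iff_mono_zsmul_id_toSheaf M m).trans
    (SheafOfModules.mono_zsmul_id_toSheaf_iff_torsionFree M m)

/-- The free sheaf of modules of rank one `𝒪 = SheafOfModules.unit R` has `m`-torsion-free
underlying abelian sheaf iff every ring of sections `R(U)` has no `m`-torsion. [folklore] -/
theorem SheafOfModules.mono_zsmul_id_toSheaf_unit_iff (m : ℤ) :
    Mono (m • 𝟙 ((SheafOfModules.toSheaf R).obj (SheafOfModules.unit R))) ↔
      ∀ (U : Cᵒᵖ) (r : R.obj.obj U), m • r = 0 → r = 0 :=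
  SheafOfModules.mono_zsmul_id_toSheaf_iff_torsionFree _ m

/-- `m • 𝟙 𝒪` is a monomorphism of sheaves of modules (`𝒪 = SheafOfModules.unit R`) iff every
ring of sections `R(U)` has no `m`-torsion. [folklore] -/
theorem SheafOfModules.mono_zsmul_id_unit_iff (m : ℤ) :
    Mono (m • 𝟙 (SheafOfModules.unit R)) ↔ ∀ (U : Cᵒᵖ) (r : R.obj.obj U), m • r = 0 → r = 0 :=
  SheafOfModules.mono_zsmul_id_iff_torsionFree _ m

/-- A free sheaf of modules of finite rank has no `m`-torsion as soon as the rings of sections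
`R(U)` have none. [folklore] -/
theorem SheafOfModules.mono_zsmul_id_free [HasWeakSheafify J AddCommGrpCat.{u}]
    [J.WEqualsLocallyBijective AddCommGrpCat.{u}] (m : ℤ) (I : Type u) [Finite I]
    (h : ∀ (U : Cᵒᵖ) (r : R.obj.obj U), m • r = 0 → r = 0) :
    Mono (m • 𝟙 (SheafOfModules.free (R := R) I)) := by
  haveI : HasFiniteBiproducts (SheafOfModules.{u} R) := HasFiniteBiproducts.of_hasFiniteProducts
  exact mono_zsmul_id_sigmaObj m (fun _ : I ↦ SheafOfModules.unit R) fun _ ↦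
    (SheafOfModules.mono_zsmul_id_unit_iff m).mpr h

/-- The sections of a free sheaf of modules of finite rank have no `m`-torsion as soon as the
rings of sections `R(U)` have none. [folklore] -/
theorem SheafOfModules.eq_zero_of_zsmul_eq_zero_free [HasWeakSheafify J AddCommGrpCat.{u}]
    [J.WEqualsLocallyBijective AddCommGrpCat.{u}] (m : ℤ) (I : Type u) [Finite I]
    (h : ∀ (U : Cᵒᵖ) (r : R.obj.obj U), m • r = 0 → r = 0) (U : Cᵒᵖ)
    (s : (SheafOfModules.free (R := R) I).val.obj U) (hs : m • s = 0) : s = 0 :=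
  (SheafOfModules.mono_zsmul_id_iff_torsionFree _ m).mp
    (SheafOfModules.mono_zsmul_id_free m I h) U s hs

end SheafOfModules

/-! ### Sheaves of `𝒪_X`-modules on a scheme -/

section Scheme

open _root_.AlgebraicGeometry

variable {X : Scheme.{u}}

/-- **Dictionary for `𝒪_X`-modules**: for `M : X.Modules` and `m : ℤ`, `m • 𝟙 M` is a
monomorphism iff for every open `U` and every section `s ∈ Γ(M, U)`, `m • s = 0` implies `s = 0`.
[folklore] -/
theorem schemeModules_mono_zsmul_id_iff_torsionFree (M : X.Modules) (m : ℤ) :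
    Mono (m • 𝟙 M) ↔ ∀ (U : X.Opens) (s : Γ(M, U)), m • s = 0 → s = 0 := by
  have h := SheafOfModules.mono_zsmul_id_iff_torsionFree (R := X.ringCatSheaf) M m
  exact h.trans ⟨fun h U ↦ h (op U), fun h U ↦ h U.unop⟩

/-- **Trivial line bundles**: an `𝒪_X`-module `M ≅ 𝒪_X` (`𝒪_X = SheafOfModules.unit`, e.g.
`M = 𝒪_X` with `e = Iso.refl _`) has no `m`-torsion iff no ring of sections `Γ(X, U)` has
`m`-torsion. [folklore] -/
theorem schemeModules_mono_zsmul_id_iff_of_iso_unit (M : X.Modules)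
    (e : M ≅ SheafOfModules.unit X.ringCatSheaf) (m : ℤ) :
    Mono (m • 𝟙 M) ↔ ∀ (U : X.Opens) (r : Γ(X, U)), m • r = 0 → r = 0 := by
  have h := SheafOfModules.mono_zsmul_id_unit_iff (R := X.ringCatSheaf) m
  exact (mono_zsmul_id_iff_of_iso m e).trans (h.trans ⟨fun h U ↦ h (op U), fun h U ↦ h U.unop⟩)

/-- **Trivial vector bundles of finite rank**: an `𝒪_X`-module `M ≅ 𝒪_X^I` with `I` finite
(`SheafOfModules.free I`) has no `m`-torsion as soon as no ring of sections `Γ(X, U)` has.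
[folklore] -/
theorem schemeModules_mono_zsmul_id_of_iso_free (M : X.Modules) {I : Type u} [Finite I]
    (e : M ≅ SheafOfModules.free (R := X.ringCatSheaf) I) (m : ℤ)
    (h : ∀ (U : X.Opens) (r : Γ(X, U)), m • r = 0 → r = 0) : Mono (m • 𝟙 M) :=
  (mono_zsmul_id_iff_of_iso m e).mpr
    (SheafOfModules.mono_zsmul_id_free (R := X.ringCatSheaf) m I fun U r ↦ h U.unop r)

end Scheme

end Literature.AlgebraicGeometry.Modules
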